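import Mathlib
import Summits.NavierStokesRegularity.NavierStokesRegularity.Theorems.ThreadingFluxAzimuthalCartanDefs
import Summits.NavierStokesRegularity.NavierStokesRegularity.Theorems.RotatingEulerWindowProfileLinearRung
import HarnessLib

/-!
# Crux `PoloidalLiouville` (stmt-NavierStokesRegularity-1222, wall W1), crux idea «azimuthal-cartan-test» (ns-idea-15 g10):
# HALF-SPACE COORDINATE TOOLKIT — the cylindrical radius `ρ`, the azimuth `φ` and `log ρ` on `{x | 0 < x₀}`

Support file (`--supports stmt-NavierStokesRegularity-1222`, helper; cell `ns-wall-extremal`, width hand ns-wall-eng-7 g7, 0 kit).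
Shared calculus for the explicit witnesses of the card (K♭ `SectorialCrossFlows` — this seat; J♭ `PoiseuilleJordanMode` — ns-wall-eng-6),
over the objects of the Defs twin `ThreadingFluxAzimuthalCartanDefs.lean` (`cylRadius`, `azimuth`, `xTest`; imported, never restated).
On the open half-space `{x | 0 < x 0}` (which contains `ball xTest 1`; hypotheses are written `0 < x 0`; no new definitions):

* the coordinate covectors are Mathlib's `EuclideanSpace.proj i` (their derivatives: the tree's `RotatingEulerWindowProfileLinearRung.hasFDerivAt_coord`, imported — dedup);
* `cylRadius_sq`, `cylSq_pos`, `cylRadius_pos` — `ρ² = x₀² + x₁²`, positivity off the axis;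
* `hasFDerivAt_cylSq`, `hasFDerivAt_logCyl` (`D log ρ = (x₀dx₀ + x₁dx₁)/ρ²`), `hasFDerivAt_cylRadius` (`Dρ = (x₀dx₀ + x₁dx₁)/ρ`),
  `hasFDerivAt_azimuth` (`Dφ = (−x₁dx₀ + x₀dx₁)/ρ²`), with the `fderiv … v` evaluation forms;
* `analyticAt_azimuth`, `analyticAt_logCyl`, `analyticAt_cylRadius` (+ `AnalyticOnNhd` on `halfSpace`) — `arctan`, `log`, `sqrt` are
  `C^ω` off their singular sets (Mathlib `Real.contDiff_arctan`, `Real.contDiffAt_log`, `Real.contDiffAt_sqrt` at level `ω`);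
* `isOpen_halfSpace`, `two_lt_apply_zero_of_mem_ball` (`ball xTest 1` lies in `{2 < x 0}`), `xTest_apply_…`.

HONEST FRAME: calculus on explicit coordinates; closes no crux or sketch Prop; `PoloidalLiouville` (1222) and NS regularity OPEN.
-/

-- the summit and its single sub-problem share the name (CONVENTIONS §1)
set_option linter.dupNamespace false

noncomputable section

namespace Summit.NavierStokesRegularity.NavierStokesRegularity.Theorems.PoloidalLiouville.AzimuthalCartan.HalfSpace

open Set Function Filter Topology Metric
open scoped ContDiff
open Summit.NavierStokesRegularity.NavierStokesRegularity.Theorems.PoloidalLiouville.CentreJet (E3)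
open Summit.NavierStokesRegularity.NavierStokesRegularity.Theorems.RotatingEulerWindowProfileLinearRung (hasFDerivAt_coord)

/-! ### Coordinates -/

/-- The coordinate covectors `dxᵢ = EuclideanSpace.proj i : y ↦ yᵢ` evaluate as expected. -/
theorem proj_apply' (i : Fin 3) (v : E3) : (EuclideanSpace.proj i : E3 →L[ℝ] ℝ) v = v i := rfl

/-- The coordinates are analytic. -/
theorem analyticAt_coord (i : Fin 3) (x : E3) : AnalyticAt ℝ (fun y : E3 => y i) x :=
  (EuclideanSpace.proj i : E3 →L[ℝ] ℝ).analyticAt x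

/-- The open half-space `{x | 0 < x₀}` (where the azimuth `arctan (x₁/x₀)` is a genuine analytic coordinate) is open. -/
theorem isOpen_halfSpace : IsOpen {x : E3 | 0 < x 0} :=
  isOpen_lt continuous_const (continuous_apply 0 |>.comp (PiLp.continuous_ofLp 2 _))

/-- The test point `xTest = (3, 0, 4)` has `x₀ = 3`. -/
@[simp] theorem xTest_apply_zero : xTest 0 = 3 := by simp [xTest]

/-- The test point has `x₁ = 0`. -/
@[simp] theorem xTest_apply_one : xTest 1 = 0 := by simp [xTest]

/-- The test point has `x₂ = 4`. -/
@[simp] theorem xTest_apply_two : xTest 2 = 4 := by simp [xTest]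

/-- On `ball xTest 1` the first coordinate exceeds `2`. -/
theorem two_lt_apply_zero_of_mem_ball {y : E3} (hy : y ∈ ball xTest 1) : 2 < y 0 := by
  rw [mem_ball, dist_eq_norm] at hy
  have h1 : |(y - xTest) 0| ≤ ‖y - xTest‖ := by
    have := PiLp.norm_apply_le (p := 2) (y - xTest) 0
    simpa using this
  have h2 : (y - xTest) 0 = y 0 - 3 := by simp
  rw [h2] at h1
  have h3 : |y 0 - 3| < 1 := lt_of_le_of_lt h1 hy
  rw [abs_lt] at h3
  linarith

/-- `ball xTest 1 ⊆ {x | 0 < x₀}`. -/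
theorem apply_zero_pos_of_mem_ball {y : E3} (hy : y ∈ ball xTest 1) : 0 < y 0 :=
  lt_trans two_pos (two_lt_apply_zero_of_mem_ball hy)

/-! ### The cylindrical radius -/

/-- `ρ² = x₀² + x₁²`. -/
theorem cylRadius_sq (x : E3) : cylRadius x ^ 2 = x 0 ^ 2 + x 1 ^ 2 :=
  Real.sq_sqrt (by positivity)

/-- `x₀² + x₁² > 0` on the half-space. -/
theorem cylSq_pos {x : E3} (hx : 0 < x 0) : 0 < x 0 ^ 2 + x 1 ^ 2 := by
  positivity

/-- `ρ > 0` on the half-space. -/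
theorem cylRadius_pos {x : E3} (hx : 0 < x 0) : 0 < cylRadius x :=
  Real.sqrt_pos.2 (cylSq_pos hx)

/-- `ρ ≠ 0` on the half-space. -/
theorem cylRadius_ne_zero {x : E3} (hx : 0 < x 0) : cylRadius x ≠ 0 := (cylRadius_pos hx).ne'

/-- `log ρ = ½ log (x₀² + x₁²)` (everywhere, by the junk conventions `√` and `log` share). -/
theorem log_cylRadius (x : E3) : Real.log (cylRadius x) = Real.log (x 0 ^ 2 + x 1 ^ 2) / 2 := by
  rw [cylRadius, Real.log_sqrt (by positivity)]

/-- Quotient rule in `fderiv` form for real functions on `ℝ³` (Mathlib has it for `HasDerivAt` only). -/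
theorem hasFDerivAt_div {f g : E3 → ℝ} {f' g' : E3 →L[ℝ] ℝ} {x : E3} (hf : HasFDerivAt f f' x) (hg : HasFDerivAt g g' x)
    (hx : g x ≠ 0) : HasFDerivAt (fun y => f y / g y) ((g x)⁻¹ • f' - (f x / g x ^ 2) • g') x := by
  have hi := (hasDerivAt_inv hx).comp_hasFDerivAt x hg
  have h := hf.mul hi
  refine h.congr_fderiv ?_ |>.congr_of_eventuallyEq ?_
  · ext v
    simp only [add_apply, sub_apply, smul_apply, smul_eq_mul, Function.comp_apply]
    field_simp
    ring
  · exact Eventually.of_forall fun y => by simp [div_eq_mul_inv]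

/-- `D(x₀² + x₁²) = 2x₀dx₀ + 2x₁dx₁`. -/
theorem hasFDerivAt_cylSq (x : E3) :
    HasFDerivAt (fun y : E3 => y 0 ^ 2 + y 1 ^ 2) ((2 * x 0) • (EuclideanSpace.proj 0 : E3 →L[ℝ] ℝ) + (2 * x 1) • (EuclideanSpace.proj 1 : E3 →L[ℝ] ℝ)) x := by
  have h := (HasFDerivAt.pow (hasFDerivAt_coord 0 x) 2).add (HasFDerivAt.pow (hasFDerivAt_coord 1 x) 2)
  refine h.congr_fderiv ?_
  ext v
  simp

/-- **`D log ρ = (x₀dx₀ + x₁dx₁)/ρ²`** off the axis. -/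
theorem hasFDerivAt_logCyl {x : E3} (hx : 0 < x 0) :
    HasFDerivAt (fun y : E3 => Real.log (cylRadius y)) ((x 0 ^ 2 + x 1 ^ 2)⁻¹ • ((x 0) • (EuclideanSpace.proj 0 : E3 →L[ℝ] ℝ) + (x 1) • (EuclideanSpace.proj 1 : E3 →L[ℝ] ℝ))) x := by
  have hs := cylSq_pos hx
  have e : (fun y : E3 => Real.log (cylRadius y)) = fun y => Real.log (y 0 ^ 2 + y 1 ^ 2) * (1 / 2) := by
    funext y; rw [log_cylRadius y]; ring
  rw [e]
  have h := (HasFDerivAt.log (hasFDerivAt_cylSq x) hs.ne').mul_const (1 / 2 : ℝ)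
  refine h.congr_fderiv ?_
  ext v
  simp only [add_apply, smul_apply, smul_eq_mul, proj_apply']
  field_simp

/-- **`Dρ = (x₀dx₀ + x₁dx₁)/ρ`** off the axis. -/
theorem hasFDerivAt_cylRadius {x : E3} (hx : 0 < x 0) :
    HasFDerivAt cylRadius ((cylRadius x)⁻¹ • ((x 0) • (EuclideanSpace.proj 0 : E3 →L[ℝ] ℝ) + (x 1) • (EuclideanSpace.proj 1 : E3 →L[ℝ] ℝ))) x := by
  have hs := cylSq_pos hx
  have hρ := cylRadius_pos hx
  have h := HasFDerivAt.sqrt (hasFDerivAt_cylSq x) hs.ne'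
  have e : cylRadius = fun y : E3 => Real.sqrt (y 0 ^ 2 + y 1 ^ 2) := rfl
  rw [e]
  refine h.congr_fderiv ?_
  ext v
  have hρ' : Real.sqrt (x 0 ^ 2 + x 1 ^ 2) = cylRadius x := rfl
  simp only [add_apply, smul_apply, smul_eq_mul, proj_apply', hρ']
  field_simp

/-- **`Dφ = (−x₁dx₀ + x₀dx₁)/ρ²`** on the half-space, `φ = arctan (x₁/x₀)`. -/
theorem hasFDerivAt_azimuth {x : E3} (hx : 0 < x 0) :
    HasFDerivAt azimuth ((x 0 ^ 2 + x 1 ^ 2)⁻¹ • (-(x 1) • (EuclideanSpace.proj 0 : E3 →L[ℝ] ℝ) + (x 0) • (EuclideanSpace.proj 1 : E3 →L[ℝ] ℝ))) x := by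
  have h0 : (x 0) ≠ 0 := hx.ne'
  have hq := hasFDerivAt_div (hasFDerivAt_coord 1 x) (hasFDerivAt_coord 0 x) h0
  have h := HasFDerivAt.arctan hq
  have e : azimuth = fun y : E3 => Real.arctan (y 1 / y 0) := rfl
  rw [e]
  refine h.congr_fderiv ?_
  ext v
  simp only [add_apply, sub_apply, smul_apply, smul_eq_mul, proj_apply']
  field_simp
  ring

/-- Evaluation forms. -/
theorem fderiv_logCyl_apply {x : E3} (hx : 0 < x 0) (v : E3) :
    fderiv ℝ (fun y : E3 => Real.log (cylRadius y)) x v = (x 0 * v 0 + x 1 * v 1) / (x 0 ^ 2 + x 1 ^ 2) := by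
  rw [(hasFDerivAt_logCyl hx).fderiv]
  simp [div_eq_inv_mul]
  ring

/-- `Dφ(x) v = (−x₁v₀ + x₀v₁)/ρ²`. -/
theorem fderiv_azimuth_apply {x : E3} (hx : 0 < x 0) (v : E3) :
    fderiv ℝ azimuth x v = (-(x 1) * v 0 + x 0 * v 1) / (x 0 ^ 2 + x 1 ^ 2) := by
  rw [(hasFDerivAt_azimuth hx).fderiv]
  simp [div_eq_inv_mul]
  ring

/-- `Dρ(x) v = (x₀v₀ + x₁v₁)/ρ`. -/
theorem fderiv_cylRadius_apply {x : E3} (hx : 0 < x 0) (v : E3) :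
    fderiv ℝ cylRadius x v = (x 0 * v 0 + x 1 * v 1) / cylRadius x := by
  rw [(hasFDerivAt_cylRadius hx).fderiv]
  simp [div_eq_inv_mul]
  ring

/-! ### Analyticity -/

/-- `x₀² + x₁²` is analytic. -/
theorem analyticAt_cylSq (x : E3) : AnalyticAt ℝ (fun y : E3 => y 0 ^ 2 + y 1 ^ 2) x :=
  ((analyticAt_coord 0 x).pow 2).add ((analyticAt_coord 1 x).pow 2)

/-- `ρ` is analytic off the axis. -/
theorem analyticAt_cylRadius {x : E3} (hx : 0 < x 0) : AnalyticAt ℝ cylRadius x := by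
  have h : AnalyticAt ℝ Real.sqrt ((fun y : E3 => y 0 ^ 2 + y 1 ^ 2) x) :=
    (Real.contDiffAt_sqrt (n := ω) (cylSq_pos hx).ne').analyticAt
  exact AnalyticAt.comp h (analyticAt_cylSq x)

/-- `log ρ` is analytic off the axis. -/
theorem analyticAt_logCyl {x : E3} (hx : 0 < x 0) : AnalyticAt ℝ (fun y : E3 => Real.log (cylRadius y)) x := by
  have h : AnalyticAt ℝ Real.log (cylRadius x) :=
    (Real.contDiffAt_log (n := ω) |>.2 (cylRadius_ne_zero hx)).analyticAt
  exact h.comp (analyticAt_cylRadius hx)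

/-- `φ = arctan (x₁/x₀)` is analytic on the half-space. -/
theorem analyticAt_azimuth {x : E3} (hx : 0 < x 0) : AnalyticAt ℝ azimuth x := by
  have h0 : (x 0) ≠ 0 := hx.ne'
  have hq : AnalyticAt ℝ (fun y : E3 => y 1 / y 0) x := (analyticAt_coord 1 x).div (analyticAt_coord 0 x) h0
  have ha : AnalyticAt ℝ Real.arctan ((fun y : E3 => y 1 / y 0) x) := (Real.contDiff_arctan (n := ω)).contDiffAt.analyticAt
  exact AnalyticAt.comp ha hq

/-- The azimuth is analytic on the half-space. -/
theorem analyticOnNhd_azimuth : AnalyticOnNhd ℝ azimuth {x : E3 | 0 < x 0} := fun _ hx => analyticAt_azimuth hx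

/-- `log ρ` is analytic on the half-space. -/
theorem analyticOnNhd_logCyl : AnalyticOnNhd ℝ (fun y : E3 => Real.log (cylRadius y)) {x : E3 | 0 < x 0} := fun _ hx =>
  analyticAt_logCyl hx

/-- `ρ` is analytic on the half-space. -/
theorem analyticOnNhd_cylRadius : AnalyticOnNhd ℝ cylRadius {x : E3 | 0 < x 0} := fun _ hx => analyticAt_cylRadius hx

end Summit.NavierStokesRegularity.NavierStokesRegularity.Theorems.PoloidalLiouville.AzimuthalCartan.HalfSpace

end
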